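import Mathlib
import HarnessLib
import Literature.NumberTheory.Automorphic.PairLFunctionPolesGLOneBoundaryUnconditional
import Literature.NumberTheory.Automorphic.PairLFunctionPolesGLOneProofs
import Literature.NumberTheory.GaloisRepresentations.HeckeLFunctionMeromorphicContinuationProofs
import Literature.NumberTheory.GaloisRepresentations.HeckeCharacterNormTwistProofs
import Literature.NumberTheory.LFunctions.RayClassLogEuler
import Literature.NumberTheory.Automorphic.ArthurClozelFibres
import Literature.NumberTheory.Automorphic.PairLFunctionPolesEqConjLowerBound

/-!
# Crux `SelfTwistedIrreducible` (stmt-Langlands-18055), line `Sketch`, stub `stub_pinnedDoublingKill`: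
# auxiliary prime-sum estimates (all primes; a non-trivial unitary Hecke character)

Real-variable prime sums `Σ_{v ∉ S} c_v q_v^{-σ}` over the finite places of a number field `F` off a
set `S`, as `σ → 1⁺`:

* `re_tsum_le_log_norm_tprod_add` — for `|c_v| ≤ 1`:
  `Re Σ_{v ∉ S} c_v q_v^{-σ} ≤ log |∏_{v ∉ S} (1 - c_v q_v^{-σ})⁻¹| + Σ_v q_v^{-2}` (the logarithm of
  the Euler product is the prime sum up to `Σ |z|²`, Heilbronn, Ch. VIII of Cassels–Fröhlich, §2);
* `exists_tendsto_partialHeckeL_of_ne_one` — for a unitary Hecke character `ν ≠ 1` unramified off the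
  finite `S`, `L^S(s, ν)` has a finite limit at `s = 1` from `Re s > 1`: `ν = θ · ‖·‖^{it}` with `θ`
  trivial on `ℝ_{>0}` (`exists_mul_eq_and_map_posRealIdele_eq_one`); for `θ ≠ 1` Hecke–Landau at
  `1 + it` (`exists_ne_zero_tendsto_partialHeckeL_of_re_eq_one`), for `θ = 1`, `t ≠ 0`, the Dedekind
  zeta function at `1 + it` (`tendsto_tprod_eulerFactor_one_of_ne_one_numberField`);
* `exists_eventually_re_tsum_heckeCharacter_le` (**main**) — hence
  `Re Σ_{v ∉ S} ν(ϖ_v) q_v^{-σ} ≤ C` for all `σ → 1⁺`.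
-/

noncomputable section

set_option linter.dupNamespace false -- `Summit.Langlands.Langlands` is the mandated namespace

namespace Summit.Langlands.Langlands.Cruxes.SelfTwistedIrreducible.DetPinning

open scoped NumberField Topology
open Filter NumberField IsDedekindDomain
open Literature.NumberTheory.GaloisRepresentations Literature.NumberTheory.Automorphic
open Literature.NumberTheory.LFunctions

variable {F : Type} [Field F] [NumberField F]

/-! ### Elementary bounds -/

/-- `Re z - |z|² ≤ Re (-log (1 - z))` for `|z| ≤ 1/2`. [folklore] -/
theorem re_sub_norm_sq_le_re_neg_log {z : ℂ} (hz : ‖z‖ ≤ 1 / 2) :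
    z.re - ‖z‖ ^ 2 ≤ (-Complex.log (1 - z)).re := by
  have h := norm_log_one_sub_add_le hz
  have h2 : |(Complex.log (1 - z) + z).re| ≤ ‖z‖ ^ 2 := (Complex.abs_re_le_norm _).trans h
  have h3 := (abs_le.mp h2).2
  simp only [Complex.add_re, Complex.neg_re] at h3 ⊢
  linarith

/-- `q_v > 0` as a real number. [folklore] -/
theorem residueCard_pos_real (v : HeightOneSpectrum (𝓞 F)) : (0 : ℝ) < v.residueCard := by
  exact_mod_cast lt_trans zero_lt_one v.one_lt_residueCard

/-- `‖c q_v^{-σ}‖ ≤ q_v^{-σ}` for `|c| ≤ 1`. [folklore] -/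
theorem norm_mul_residueCard_cpow_le (v : HeightOneSpectrum (𝓞 F)) {c : ℂ} (hc : ‖c‖ ≤ 1)
    (σ : ℝ) : ‖c * (v.residueCard : ℂ) ^ (-(σ : ℂ))‖ ≤ (v.residueCard : ℝ) ^ (-σ) :=
  norm_mul_absNorm_cpow_le v hc σ

/-- `q_v^{-σ} ≤ 1/2` for `σ ≥ 1`. [folklore] -/
theorem residueCard_rpow_neg_le_half (v : HeightOneSpectrum (𝓞 F)) {σ : ℝ} (hσ : 1 ≤ σ) :
    (v.residueCard : ℝ) ^ (-σ) ≤ 1 / 2 :=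
  absNorm_rpow_neg_le_half v hσ

/-- `Σ_v q_v^{-σ}` converges for `σ > 1` (as a family on any subtype of places). [folklore] -/
theorem summable_residueCard_rpow_neg_subtype (p : HeightOneSpectrum (𝓞 F) → Prop) {σ : ℝ}
    (hσ : 1 < σ) : Summable fun v : {v // p v} => (v.1.residueCard : ℝ) ^ (-σ) :=
  (Literature.NumberTheory.LFunctions.summable_absNorm_rpow_neg hσ).comp_injective
    Subtype.val_injective

/-! ### The logarithm of an Euler product dominates the prime sum -/

/-- **`Re Σ_{v ∉ S} c_v q_v^{-σ} ≤ log |∏_{v ∉ S} (1 - c_v q_v^{-σ})⁻¹| + Σ_v q_v^{-2}`** for `σ > 1`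
and `|c_v| ≤ 1`: the Euler product is `exp` of `Σ -log(1 - z_v)`, `z_v = c_v q_v^{-σ}`, and
`Re(-log(1 - z)) ≥ Re z - |z|²`, `|z_v|² ≤ q_v^{-2}` (Heilbronn, *Zeta-functions and L-functions*,
Ch. VIII of Cassels–Fröhlich, §2, Note after Thm. 5). [folklore] -/
theorem re_tsum_le_log_norm_tprod_add (S : Set (HeightOneSpectrum (𝓞 F)))
    {c : HeightOneSpectrum (𝓞 F) → ℂ} (hc : ∀ v, ‖c v‖ ≤ 1) {σ : ℝ} (hσ : 1 < σ) :
    0 < ‖∏' v : {v // v ∉ S}, (1 - c v.1 * (v.1.residueCard : ℂ) ^ (-(σ : ℂ)))⁻¹‖ ∧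
    (∑' v : {v // v ∉ S}, c v.1 * (v.1.residueCard : ℂ) ^ (-(σ : ℂ))).re ≤
      Real.log ‖∏' v : {v // v ∉ S}, (1 - c v.1 * (v.1.residueCard : ℂ) ^ (-(σ : ℂ)))⁻¹‖ +
        ∑' v : HeightOneSpectrum (𝓞 F), (v.residueCard : ℝ) ^ (-(2 : ℝ)) := by
  set T := {v : HeightOneSpectrum (𝓞 F) // v ∉ S}
  set z : T → ℂ := fun v => c v.1 * (v.1.residueCard : ℂ) ^ (-(σ : ℂ)) with hzdef
  have hz1 : ∀ v : T, ‖z v‖ ≤ (v.1.residueCard : ℝ) ^ (-σ) := fun v =>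
    norm_mul_residueCard_cpow_le v.1 (hc v.1) σ
  have hz2 : ∀ v : T, ‖z v‖ ≤ 1 / 2 := fun v =>
    (hz1 v).trans (residueCard_rpow_neg_le_half v.1 hσ.le)
  have hsq : Summable fun v : T => (v.1.residueCard : ℝ) ^ (-σ) :=
    summable_residueCard_rpow_neg_subtype _ hσ
  have hzs : Summable fun v : T => ‖z v‖ := hsq.of_nonneg_of_le (fun _ => norm_nonneg _) hz1
  -- the logarithmic series
  set g : T → ℂ := fun v => -Complex.log (1 - z v) with hgdef
  have hgs : Summable fun v : T => ‖g v‖ := by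
    refine (hzs.mul_left (3 / 2)).of_nonneg_of_le (fun _ => norm_nonneg _) fun v => ?_
    rw [hgdef, norm_neg]
    exact norm_log_one_sub_le (hz2 v)
  have hg : HasSum g (∑' v, g v) := hgs.of_norm.hasSum
  -- exponentiate: the Euler product is `exp (Σ g)`
  have hne : ∀ v : T, (1 : ℂ) - z v ≠ 0 := fun v h0 => by
    have : ‖z v‖ = 1 := by rw [← sub_eq_zero.mp h0, norm_one]
    linarith [hz2 v]
  have hprod : ∏' v : T, (1 - z v)⁻¹ = Complex.exp (∑' v, g v) := by
    have h := hg.cexp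
    have hfun : (Complex.exp ∘ g) = fun v : T => (1 - z v)⁻¹ := by
      funext v
      simp only [Function.comp_apply, hgdef, Complex.exp_neg, Complex.exp_log (hne v)]
    rw [hfun] at h
    exact h.tprod_eq
  have hnorm : ‖∏' v : T, (1 - z v)⁻¹‖ = Real.exp (∑' v, g v).re := by
    rw [hprod, Complex.norm_exp]
  refine ⟨by rw [hnorm]; exact Real.exp_pos _, ?_⟩
  rw [hnorm, Real.log_exp, Complex.re_tsum hgs.of_norm]
  -- compare termwise: `Re z_v - |z_v|² ≤ Re g_v`, `|z_v|² ≤ q_v^{-2}`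
  have hzs2 : Summable fun v : T => ‖z v‖ ^ 2 := by
    refine (hzs.mul_left (1 / 2)).of_nonneg_of_le (fun _ => sq_nonneg _) fun v => ?_
    rw [sq]
    exact mul_le_mul_of_nonneg_right (hz2 v) (norm_nonneg _)
  have hre : Summable fun v : T => (z v).re := (Complex.hasSum_re hzs.of_norm.hasSum).summable
  have hgre : Summable fun v : T => (g v).re := (Complex.hasSum_re hg).summable
  have h1 : ∑' v : T, ((z v).re - ‖z v‖ ^ 2) ≤ ∑' v : T, (g v).re :=
    Summable.tsum_le_tsum (fun v => re_sub_norm_sq_le_re_neg_log (hz2 v)) (hre.sub hzs2) hgre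
  rw [hre.tsum_sub hzs2, ← Complex.re_tsum hzs.of_norm] at h1
  have h2 : ∑' v : T, ‖z v‖ ^ 2 ≤ ∑' v : HeightOneSpectrum (𝓞 F), (v.residueCard : ℝ) ^ (-(2 : ℝ)) := by
    have hq2 : Summable fun v : HeightOneSpectrum (𝓞 F) => (v.residueCard : ℝ) ^ (-(2 : ℝ)) :=
      Literature.NumberTheory.LFunctions.summable_absNorm_rpow_neg one_lt_two
    calc ∑' v : T, ‖z v‖ ^ 2 ≤ ∑' v : T, (v.1.residueCard : ℝ) ^ (-(2 : ℝ)) := by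
          refine Summable.tsum_le_tsum (fun v => ?_) hzs2 (hq2.comp_injective Subtype.val_injective)
          have hq1 : (1 : ℝ) ≤ v.1.residueCard := by exact_mod_cast v.1.one_lt_residueCard.le
          calc ‖z v‖ ^ 2 ≤ ((v.1.residueCard : ℝ) ^ (-σ)) ^ 2 := by
                gcongr
                exact hz1 v
            _ = (v.1.residueCard : ℝ) ^ (-σ * 2) := by
                rw [Real.rpow_mul (residueCard_pos_real v.1).le]; norm_cast
            _ ≤ (v.1.residueCard : ℝ) ^ (-(2 : ℝ)) :=
                Real.rpow_le_rpow_of_exponent_le hq1 (by linarith)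
      _ ≤ ∑' v : HeightOneSpectrum (𝓞 F), (v.residueCard : ℝ) ^ (-(2 : ℝ)) :=
          hq2.tsum_subtype_le _ {v | v ∉ S} (fun v => Real.rpow_nonneg (Nat.cast_nonneg _) _)
  linarith

/-! ### Boundedness of a logarithm along `σ → 1⁺` -/

/-- If `G(σ) → c` as `σ → 1⁺` then eventually `log ‖G σ‖ ≤ log (‖c‖ + 1)`. [folklore] -/
theorem eventually_log_norm_le_of_tendsto {G : ℝ → ℂ} {c : ℂ}
    (h : Tendsto G (𝓝[>] (1 : ℝ)) (𝓝 c)) :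
    ∀ᶠ σ : ℝ in 𝓝[>] 1, Real.log ‖G σ‖ ≤ Real.log (‖c‖ + 1) := by
  filter_upwards [h.norm.eventually_lt_const (lt_add_one ‖c‖)] with σ hσ
  rcases (norm_nonneg (G σ)).eq_or_lt with h0 | hpos
  · rw [← h0, Real.log_zero]
    exact Real.log_nonneg (by linarith [norm_nonneg c])
  · exact Real.log_le_log hpos hσ.le

/-! ### A non-trivial unitary Hecke character: `L^S(s, ν)` is finite at `s = 1` -/

/-- **`L^S(s, ν)` has a finite limit at `s = 1` for unitary `ν ≠ 1`.** For a unitary Hecke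
character `ν ≠ 1` of `F` unramified off the finite `S`, `∏_{v ∉ S} (1 - ν(ϖ_v) q_v^{-s})⁻¹`
converges as `s → 1`, `Re s > 1`. Write `ν = θ · ‖·‖^z` with `θ` unitary, trivial on `ℝ_{>0}`,
`Re z = 0` (Tate §4.3, `exists_mul_eq_and_map_posRealIdele_eq_one`); then
`L^S(s, ν) = L^S(s + z, θ)`; if `θ ≠ 1` use Hecke–Landau at `1 + z`
(`exists_ne_zero_tendsto_partialHeckeL_of_re_eq_one`), if `θ = 1` then `z ≠ 0` and
`L^S(s, θ) = ζ_F^S(s)` is finite at `1 + z ≠ 1` (`tendsto_tprod_eulerFactor_one_of_ne_one_numberField`).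
[cite: Iwasawa2019, Ch. 4 §4.2 Prop. 4.4] [cite: LandauMathAnn1903] -/
theorem exists_tendsto_partialHeckeL_of_ne_one {ν : HeckeCharacter F} (hu : ν.IsUnitary)
    (h1 : ν ≠ 1) {S : Set (HeightOneSpectrum (𝓞 F))} (hS : S.Finite)
    (hur : ∀ v ∉ S, ν.IsUnramifiedAt v) :
    ∃ c : ℂ, Tendsto (fun s : ℂ => ∏' v : {v // v ∉ S},
      (1 - ν.valueAtUniformizer v.1 * ((v.1.residueCard : ℂ) ^ (-s)))⁻¹)
      (𝓝[{s : ℂ | 1 < s.re}] 1) (𝓝 c) := by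
  obtain ⟨θ, N, z, hθu, hθA, hz, hN, hνeq⟩ :=
    HeckeCharacter.exists_mul_eq_and_map_posRealIdele_eq_one hu
  -- `N = ‖·‖^z` is unramified everywhere, so `θ = ν N⁻¹` is unramified off `S`
  have hNur : ∀ v, N.IsUnramifiedAt v := fun v =>
    HeckeCharacter.IsNormTwist.isUnramifiedAt_holds ⟨z, hN⟩ v
  have hθeq : θ = ν * N⁻¹ := by rw [hνeq, mul_inv_cancel_right]
  have hθur : ∀ v ∉ S, θ.IsUnramifiedAt v := fun v hv => by
    rw [hθeq]
    exact (hur v hv).mul (HeckeCharacter.isUnramifiedAt_inv_iff.mpr (hNur v))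
  -- the values: `ν(ϖ_v) = θ(ϖ_v) q_v^{-z}`
  have hval : ∀ v : HeightOneSpectrum (𝓞 F),
      ν.valueAtUniformizer v = θ.valueAtUniformizer v * (v.residueCard : ℂ) ^ (-z) := fun v => by
    rw [hνeq, HeckeCharacter.valueAtUniformizer_mul,
      HeckeCharacter.valueAtUniformizer_of_forall_apply_eq_cpow hN v]
    rfl
  set G : ℂ → ℂ := fun s => ∏' v : {v : HeightOneSpectrum (𝓞 F) // v ∉ S},
    (1 - θ.valueAtUniformizer v.1 * ((v.1.residueCard : ℂ) ^ (-s)))⁻¹ with hG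
  have hshift : (fun s : ℂ => ∏' v : {v : HeightOneSpectrum (𝓞 F) // v ∉ S},
      (1 - ν.valueAtUniformizer v.1 * ((v.1.residueCard : ℂ) ^ (-s)))⁻¹) = fun s => G (s + z) := by
    funext s
    simp only [hG]
    refine tprod_congr fun v => ?_
    have hq : (v.1.residueCard : ℂ) ≠ 0 :=
      Nat.cast_ne_zero.2 (ne_of_gt (lt_trans zero_lt_one v.1.one_lt_residueCard))
    rw [hval v.1, mul_assoc, ← Complex.cpow_add _ _ hq, neg_add, add_comm (-z) (-s)]
  -- the limit of `G` at `1 + z`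
  have hGlim : ∃ c : ℂ, Tendsto G (𝓝[{s : ℂ | 1 < s.re}] (1 + z)) (𝓝 c) := by
    by_cases hθ1 : θ = 1
    · -- `θ = 1`: `z ≠ 0` and `G = ζ_F^S`
      have hz0 : z ≠ 0 := by
        rintro rfl
        apply h1
        rw [hνeq, hθ1, one_mul]
        ext x
        have := hN x
        rw [Complex.cpow_zero] at this
        rw [HeckeCharacter.one_apply, Units.val_one, this]
      have hs1 : (1 + z : ℂ) ≠ 1 := fun h => hz0 (by simpa using h)
      obtain ⟨c, -, hc⟩ := tendsto_tprod_eulerFactor_one_of_ne_one_numberField (K := F) hS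
        (s₀ := 1 + z) (by simp [hz]) hs1
      refine ⟨c, hc.congr' (Eventually.of_forall fun s => ?_)⟩
      simp only [hG, hθ1]
      exact tprod_congr fun v => by rw [show (1 : HeckeCharacter F).valueAtUniformizer v.1 = 1 from rfl, one_mul]
    · obtain ⟨c, -, hc⟩ := exists_ne_zero_tendsto_partialHeckeL_of_re_eq_one θ hθu hθA hθ1 hS hθur
        (s₀ := 1 + z) (by simp [hz])
      exact ⟨c, hc⟩
  obtain ⟨c, hc⟩ := hGlim
  refine ⟨c, ?_⟩
  rw [hshift]
  exact hc.comp (tendsto_add_const_nhdsWithin_one_lt_re hz)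

/-- **The Hecke side of the determinant pinning.** For a unitary Hecke character `ν ≠ 1` of `F`
unramified off the finite `S`, there is `C` with `Re Σ_{v ∉ S} ν(ϖ_v) q_v^{-σ} ≤ C` for all real
`σ → 1⁺`: `L^S(σ, ν)` stays bounded (`exists_tendsto_partialHeckeL_of_ne_one`) and its logarithm
dominates the prime sum (`re_tsum_le_log_norm_tprod_add`). This is the classical first step of
Dirichlet–Hecke density arguments (Heilbronn, Ch. VIII of Cassels–Fröhlich, §2).
[cite: HeilbronnZetaL1967, §2 Note after Theorem 5] -/
theorem exists_eventually_re_tsum_heckeCharacter_le :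
    ∀ {F : Type} [Field F] [NumberField F] {ν : HeckeCharacter F}, ν.IsUnitary → ν ≠ 1 →
      ∀ {S : Set (HeightOneSpectrum (𝓞 F))}, S.Finite → (∀ v ∉ S, ν.IsUnramifiedAt v) →
        ∃ C : ℝ, ∀ᶠ σ : ℝ in nhdsWithin 1 (Set.Ioi 1),
          (∑' v : {v // v ∉ S},
            ν.valueAtUniformizer v.1 * (v.1.residueCard : ℂ) ^ (-(σ : ℂ))).re ≤ C := by
  intro F _ _ ν hu h1 S hS hur
  obtain ⟨c, hc⟩ := exists_tendsto_partialHeckeL_of_ne_one hu h1 hS hur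
  have hcℝ := hc.comp tendsto_ofReal_nhdsWithin_one
  refine ⟨Real.log (‖c‖ + 1) + ∑' v : HeightOneSpectrum (𝓞 F), (v.residueCard : ℝ) ^ (-(2 : ℝ)), ?_⟩
  filter_upwards [eventually_log_norm_le_of_tendsto hcℝ, self_mem_nhdsWithin] with σ hlog hσ1
  have hσ : 1 < σ := hσ1
  have hcv : ∀ v : HeightOneSpectrum (𝓞 F), ‖ν.valueAtUniformizer v‖ ≤ 1 := fun v =>
    (HeckeCharacter.norm_valueAtUniformizer_of_isUnitary hu v).le
  obtain ⟨-, hle⟩ := re_tsum_le_log_norm_tprod_add S hcv hσ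
  simp only [Function.comp_apply] at hlog
  linarith

end Summit.Langlands.Langlands.Cruxes.SelfTwistedIrreducible.DetPinning

end
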